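import Literature.Topology.FourManifolds.EuclideanCollarCriterion
import Literature.Topology.FourManifolds.GradientCollarField
import Literature.Topology.FourManifolds.SmoothEmbeddingCriteria
import Literature.Topology.FourManifolds.ClosedBallProofs
import Literature.Analysis.ODE.CompactSupportFlow
import Mathlib.Analysis.Calculus.ContDiff.RCLike

/-!
# The gradient collar of a compact regular hypersurface `{F = 0}` of Euclidean space

Topic `Literature/Topology/FourManifolds` (infrastructure for the fact seat
`provefact-Literature.Geometry.Riemannian.LawsonMichelsohn1984_surrounding`: the strong isotopy of
Lawson–Michelsohn's Thm. 6.1 starts by pushing the hypersurface `e(N) = {F = 0} = ∂{F ≤ 0}` into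
the domain along the normalised gradient of `F`; this file realises that push as Euclidean collar
data (`EuclideanCollarData`, `EuclideanCollarCriterion.lean`), whence a smooth embedding
`N × [0, 1] → ℝⁿ⁺²` between `e` and the level `{F = -η}`).  Everything here is **proved**.

For a real Banach space `E`, a bounded Lipschitz field `g` on `E` with global flow `θ`
(`Literature.Analysis.ODE.globalFlow`) and a differentiable `F : E → ℝ`:

* `norm_globalFlow_sub_le` — `‖θ_t q - q‖ ≤ L |t|` (bounded speed);
* `hasDerivAt_comp_globalFlow`, `monotone_comp_globalFlow`, `antitone_comp_globalFlow_sub`,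
  `comp_globalFlow_eq_add` — the clock `s ↦ F (θ_s q)`: derivative `dF(g)`, monotone when
  `dF(g) ≥ 0`, of slope `≤ 1` when `dF(g) ≤ 1`, and *equal to `F q + s`* as long as `dF(g) = 1`
  along the track.

For a `C^∞` function `F` on a finite-dimensional inner product space with `{F ≤ 0}` compact and
`dF ≠ 0` on `{F = 0}`:

* `exists_gradientCollarFlow` — **the gradient collar flow**: a jointly smooth complete flow `θ`
  of `E` (the flow of the cut-off normalised gradient, `exists_gradientCollarField`), the identity
  off a compact set, along which `F` is non-decreasing with slope `≤ 1`, an open `O ⊇ {F = 0}` on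
  which `dF ≠ 0`, and `η₀ > 0` such that `F (θ_s z) = F z + s` for `z ∈ O`, `|s| ≤ 4η₀`, the band
  `{-4η₀ ≤ F ≤ 0}` lies in `O`, tracks from `{F = 0}` stay in `O` for `|s| ≤ 4η₀`, and `θ_{-s}`
  carries `{F ≤ 0}` onto `{F ≤ -s}` and `{F = 0}` onto `{F = -s}` (`0 ≤ s ≤ 4η₀`);
* `exists_bandFlow`, `exists_euclideanCollarData_of_band` — **the regular interval theorem in
  `ℝⁿ⁺²`**: across a compact band `{lo' ≤ F ≤ hi'}` without critical points the clock
  `F (θ_s z) = F z + s` holds as long as the level stays in the band, and for a smooth embedding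
  `e` onto the level `{F = hi}` (`lo' < lo < hi < hi'`) the map `(x, t) ↦ θ_{-(hi-lo)t} (e x)`
  underlies Euclidean collar data: a smooth embedding `N × [0, 1] → ℝⁿ⁺²` onto `{lo ≤ F ≤ hi}`;
* `exists_euclideanCollarData` — for a smooth embedding `e : N → ℝⁿ⁺²` of a compact manifold
  onto `{F = 0}` and every `η ∈ (0, η₀]`: Euclidean collar data `D` with
  `D.toFun x t = θ_{-ηt} (e x)`, `F (D.toFun x t) = -ηt`, every level `{F = -ηt}`,
  `0 ≤ t ≤ 4`, swept exactly; hence (`EuclideanCollarData.isSmoothEmbedding_collarMap`) the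
  **strong isotopy `N × [0, 1] → ℝⁿ⁺²` from `e` to the level `{F = -η}`**, and `x ↦ θ_{-η} (e x)` is
  again a smooth embedding, onto `{F = -η}`.

## References

* J. Milnor, *Morse theory* (1963), Thm. 3.1 (regular interval theorem: pushing levels along the
  normalised gradient). [Milnor1963]
* J. Milnor, *Lectures on the h-cobordism theorem* (1965), Thm. 3.4 / collar neighbourhood
  theorem. [MilnorHCobordism1965]
* S. Lang, *Differential and Riemannian Manifolds* (1995), Ch. IV §1. [Lang1995]
-/

noncomputable section

open Set Function Metric
open scoped Topology ContDiff Manifold NNReal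

namespace Literature.Topology.FourManifolds

open Literature.Analysis.ODE

universe u

/-! ### Bounded speed and the clock along a global flow -/

section Flow

variable {E : Type*} [NormedAddCommGroup E] [NormedSpace ℝ E] [CompleteSpace E]
  {g : E → E} {K : ℝ≥0} {L : ℝ} {F : E → ℝ}

/-- **Bounded speed**: a flow line of a field bounded by `L` moves at most `L |t|` in time `t`.
[cite: Lang1995, Ch. IV §1] -/
theorem norm_globalFlow_sub_le (hK : LipschitzWith K g) (hL : ∀ q, ‖g q‖ ≤ L) (q : E) (t : ℝ) :
    ‖globalFlow hK hL q t - q‖ ≤ L * |t| := by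
  have h := (convex_univ (𝕜 := ℝ) (E := ℝ)).norm_image_sub_le_of_norm_hasDerivWithin_le
    (f := globalFlow hK hL q) (f' := fun s => g (globalFlow hK hL q s)) (C := L)
    (fun s _ => (hasDerivAt_globalFlow hK hL q s).hasDerivWithinAt) (fun s _ => hL _)
    (mem_univ 0) (mem_univ t)
  rwa [globalFlow_zero, sub_zero, Real.norm_eq_abs] at h

/-- Bounded speed, distance form. [cite: Lang1995, Ch. IV §1] -/
theorem dist_globalFlow_le (hK : LipschitzWith K g) (hL : ∀ q, ‖g q‖ ≤ L) (q : E) (t : ℝ) :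
    dist (globalFlow hK hL q t) q ≤ L * |t| := by
  rw [dist_eq_norm]; exact norm_globalFlow_sub_le hK hL q t

/-- The clock `s ↦ F (θ_s q)` has derivative `dF(g)` at the moving point. [folklore] -/
theorem hasDerivAt_comp_globalFlow (hF : Differentiable ℝ F) (hK : LipschitzWith K g)
    (hL : ∀ q, ‖g q‖ ≤ L) (q : E) (t : ℝ) :
    HasDerivAt (fun s => F (globalFlow hK hL q s))
      (fderiv ℝ F (globalFlow hK hL q t) (g (globalFlow hK hL q t))) t :=
  (hF _).hasFDerivAt.comp_hasDerivAt t (hasDerivAt_globalFlow hK hL q t)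

/-- If `dF(g) ≥ 0` everywhere, `F` is non-decreasing along the flow. [cite: Milnor1963, Thm. 3.1] -/
theorem monotone_comp_globalFlow (hF : Differentiable ℝ F) (hK : LipschitzWith K g)
    (hL : ∀ q, ‖g q‖ ≤ L) (h0 : ∀ x, 0 ≤ fderiv ℝ F x (g x)) (q : E) :
    Monotone fun s => F (globalFlow hK hL q s) :=
  monotone_of_hasDerivAt_nonneg (fun t => hasDerivAt_comp_globalFlow hF hK hL q t) fun _ => h0 _

/-- If `dF(g) ≤ 1` everywhere, `F (θ_s q) - s` is non-increasing: `F` grows with slope at most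
`1` along the flow. [cite: Milnor1963, Thm. 3.1] -/
theorem antitone_comp_globalFlow_sub (hF : Differentiable ℝ F) (hK : LipschitzWith K g)
    (hL : ∀ q, ‖g q‖ ≤ L) (h1 : ∀ x, fderiv ℝ F x (g x) ≤ 1) (q : E) :
    Antitone fun s => F (globalFlow hK hL q s) - s :=
  antitone_of_hasDerivAt_nonpos
    (fun t => (hasDerivAt_comp_globalFlow hF hK hL q t).sub (hasDerivAt_id t)) fun t => by
    show fderiv ℝ F _ (g _) - 1 ≤ 0
    linarith [h1 (globalFlow hK hL q t)]

/-- **The clock**: if `dF(g) = 1` along the track between times `0` and `s`, then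
`F (θ_s q) = F q + s`. [cite: Milnor1963, Thm. 3.1] -/
theorem comp_globalFlow_eq_add (hF : Differentiable ℝ F) (hK : LipschitzWith K g)
    (hL : ∀ q, ‖g q‖ ≤ L) (q : E) {s : ℝ}
    (h : ∀ u ∈ uIcc 0 s, fderiv ℝ F (globalFlow hK hL q u) (g (globalFlow hK hL q u)) = 1) :
    F (globalFlow hK hL q s) = F q + s := by
  have key := (convex_uIcc (0 : ℝ) s).norm_image_sub_le_of_norm_hasDerivWithin_le
    (f := fun u => F (globalFlow hK hL q u) - u)
    (f' := fun u => fderiv ℝ F (globalFlow hK hL q u) (g (globalFlow hK hL q u)) - 1) (C := 0)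
    (fun u _ => ((hasDerivAt_comp_globalFlow hF hK hL q u).sub (hasDerivAt_id u)).hasDerivWithinAt)
    (fun u hu => by rw [h u hu, sub_self, norm_zero]) left_mem_uIcc right_mem_uIcc
  rw [zero_mul, norm_le_zero_iff, globalFlow_zero, sub_zero, sub_eq_zero] at key
  linarith

end Flow

/-! ### The gradient collar flow of a compact regular hypersurface -/

section Apart

variable {X : Type*} [TopologicalSpace X] {F : X → ℝ}

/-- Away from an open neighbourhood of its zero set, a continuous function with compact
non-positive region is bounded away from `0` on that region. [folklore] -/
theorem exists_forall_le_neg_of_notMem (hF : Continuous F) (hD : IsCompact {x | F x ≤ 0})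
    {O : Set X} (hO : IsOpen O) (hZO : {x | F x = 0} ⊆ O) :
    ∃ c : ℝ, 0 < c ∧ ∀ z, F z ≤ 0 → z ∉ O → F z ≤ -c := by
  have hKc : IsCompact ({x | F x ≤ 0} \ O) := hD.diff hO
  rcases ({x | F x ≤ 0} \ O).eq_empty_or_nonempty with hKe | hKne
  · refine ⟨1, one_pos, fun z hz hzO => ?_⟩
    have : z ∈ {x | F x ≤ 0} \ O := ⟨hz, hzO⟩
    rw [hKe] at this
    exact this.elim
  · obtain ⟨x₀, hx₀, hmax⟩ := hKc.exists_isMaxOn hKne hF.continuousOn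
    have hx₀neg : F x₀ < 0 := by
      have h1 : F x₀ ≤ 0 := hx₀.1
      rcases h1.lt_or_eq with h | h
      · exact h
      · exact (hx₀.2 (hZO h)).elim
    exact ⟨-F x₀, by linarith, fun z hz hzO => by
      have := hmax ⟨hz, hzO⟩
      simp only [mem_setOf_eq] at this
      linarith⟩

end Apart

section Gradient

variable {E : Type*} [NormedAddCommGroup E] [InnerProductSpace ℝ E] [FiniteDimensional ℝ E]
  {F : E → ℝ}

/-- **The gradient collar flow of a compact regular hypersurface `{F = 0}`** (Milnor's proof of
the regular interval theorem, in `E`): for a `C^∞` function `F` on a finite-dimensional inner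
product space with `{F ≤ 0}` compact and `dF ≠ 0` on `{F = 0}` there are a jointly smooth
complete flow `θ` on `E` — the identity off a compact set, with `F` non-decreasing of slope `≤ 1`
along it —, an open set `O ⊇ {F = 0}` on which `dF ≠ 0`, and `η₀ > 0`, such that: the clock
`F (θ_s z) = F z + s` holds for `z ∈ O` and `|s| ≤ 4η₀`; the band `{-4η₀ ≤ F ≤ 0}` lies in `O`;
tracks starting on `{F = 0}` stay in `O` for `|s| ≤ 4η₀`; and for `0 ≤ s ≤ 4η₀` the time `-s`
map carries `{F ≤ 0}` onto `{F ≤ -s}` and `{F = 0}` onto `{F = -s}`.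
[cite: Milnor1963, Thm. 3.1] [cite: MilnorHCobordism1965, Thm. 3.4] -/
theorem exists_gradientCollarFlow (hF : ContDiff ℝ ∞ F) (hD : IsCompact {x | F x ≤ 0})
    (hreg : ∀ x, F x = 0 → fderiv ℝ F x ≠ 0) :
    ∃ (η₀ : ℝ) (θ : E → ℝ → E) (O : Set E), 0 < η₀ ∧
      ContDiff ℝ ∞ (fun p : E × ℝ => θ p.1 p.2) ∧
      (∀ z, θ z 0 = z) ∧ (∀ z s t, θ z (s + t) = θ (θ z s) t) ∧
      (∃ S : Set E, IsCompact S ∧ ∀ z ∉ S, ∀ s, θ z s = z) ∧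
      (∀ z, Monotone fun s => F (θ z s)) ∧ (∀ z, Antitone fun s => F (θ z s) - s) ∧
      IsOpen O ∧ {x | F x = 0} ⊆ O ∧ (∀ z ∈ O, fderiv ℝ F z ≠ 0) ∧
      (∀ z ∈ O, ∀ s ∈ Icc (-(4 * η₀)) (4 * η₀), F (θ z s) = F z + s) ∧
      (∀ z, F z ≤ 0 → -(4 * η₀) ≤ F z → z ∈ O) ∧
      (∀ z, F z = 0 → ∀ s ∈ Icc (-(4 * η₀)) (4 * η₀), θ z s ∈ O) ∧
      (∀ s ∈ Icc 0 (4 * η₀), (fun z => θ z (-s)) '' {x | F x ≤ 0} = {x | F x ≤ -s}) ∧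
      (∀ s ∈ Icc 0 (4 * η₀), (fun z => θ z (-s)) '' {x | F x = 0} = {x | F x = -s}) := by
  haveI : CompleteSpace E := FiniteDimensional.complete ℝ E
  set Z : Set E := {x | F x = 0} with hZ
  have hZc : IsCompact Z :=
    hD.of_isClosed_subset (isClosed_eq hF.continuous continuous_const) fun x hx => le_of_eq hx
  -- the cut-off normalised gradient and its flow
  obtain ⟨ρ, L, V, hρ, hL, hVc, hVcs, hdFV, hdFV1, hVL, hV0, hreg2⟩ :=
    exists_gradientCollarField hF hZc fun x hx => hreg x hx
  obtain ⟨K, hK⟩ := hVc.lipschitzWith_of_hasCompactSupport hVcs (by simp)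
  set θ : E → ℝ → E := globalFlow hK hVL with hθ
  have hFd : Differentiable ℝ F := hF.differentiable (by simp)
  have hθc : ContDiff ℝ ∞ fun p : E × ℝ => θ p.1 p.2 :=
    contDiff_globalFlow (n := (⊤ : ℕ∞)) hVc le_top hK hVL
  have hmono : ∀ z, Monotone fun s => F (θ z s) := fun z =>
    monotone_comp_globalFlow hFd hK hVL (fun x => (hdFV x).1) z
  have hanti : ∀ z, Antitone fun s => F (θ z s) - s := fun z =>
    antitone_comp_globalFlow_sub hFd hK hVL (fun x => (hdFV x).2) z
  have hdist : ∀ z s, dist (θ z s) z ≤ L * |s| := fun z s => dist_globalFlow_le hK hVL z s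
  -- the open set `O` and the constant `c`
  set O : Set E := thickening (ρ / 2) Z with hO
  have hOo : IsOpen O := isOpen_thickening
  have hZO : Z ⊆ O := self_subset_thickening (by positivity) Z
  have hO2ρ : O ⊆ cthickening (2 * ρ) Z :=
    (thickening_subset_cthickening _ Z).trans (cthickening_mono (by linarith) Z)
  obtain ⟨c, hc, hcO⟩ := exists_forall_le_neg_of_notMem hF.continuous hD hOo hZO
  -- the time `η₀`
  set η₀ : ℝ := min (ρ / (16 * (L + 1))) (c / 8) with hη₀
  have hη₀pos : 0 < η₀ := lt_min (by positivity) (by positivity)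
  have hη₀ρ : 4 * η₀ * L ≤ ρ / 4 := by
    have h1 : η₀ ≤ ρ / (16 * (L + 1)) := min_le_left _ _
    have h2 : η₀ * (16 * (L + 1)) ≤ ρ := by
      rw [← le_div_iff₀ (by positivity)]; exact h1
    nlinarith [hη₀pos.le, hL]
  have hη₀c : 4 * η₀ < c := by
    have : η₀ ≤ c / 8 := min_le_right _ _
    linarith
  -- tracks of length `≤ 4η₀` from `O` stay where `dF(V) = 1`
  have htrack : ∀ z ∈ O, ∀ u : ℝ, |u| ≤ 4 * η₀ → θ z u ∈ cthickening ρ Z := by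
    intro z hz u hu
    obtain ⟨y, hy, hzy⟩ := mem_thickening_iff.1 hz
    refine mem_cthickening_of_dist_le _ y _ _ hy ?_
    calc dist (θ z u) y ≤ dist (θ z u) z + dist z y := dist_triangle _ _ _
      _ ≤ L * |u| + ρ / 2 := add_le_add (hdist z u) hzy.le
      _ ≤ ρ := by nlinarith [abs_nonneg u, hL]
  have hclock : ∀ z ∈ O, ∀ s ∈ Icc (-(4 * η₀)) (4 * η₀), F (θ z s) = F z + s := by
    intro z hz s hs
    refine comp_globalFlow_eq_add hFd hK hVL z fun u hu => hdFV1 _ (htrack z hz u ?_)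
    rw [abs_le]
    rcases le_total 0 s with h0s | hs0
    · rw [uIcc_of_le h0s] at hu
      exact ⟨by linarith [hu.1, hs.2], by linarith [hu.2, hs.2]⟩
    · rw [uIcc_of_ge hs0] at hu
      exact ⟨by linarith [hu.1, hs.1], by linarith [hu.2, hs.1]⟩
  have hband : ∀ z, F z ≤ 0 → -(4 * η₀) ≤ F z → z ∈ O := by
    intro z hz hz'
    by_contra hzO
    have := hcO z hz hzO
    linarith
  have hstay : ∀ z, F z = 0 → ∀ s ∈ Icc (-(4 * η₀)) (4 * η₀), θ z s ∈ O := by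
    intro z hz s hs
    refine mem_thickening_iff.2 ⟨z, hz, ?_⟩
    calc dist (θ z s) z ≤ L * |s| := hdist z s
      _ ≤ ρ / 4 := by nlinarith [abs_le.2 (And.intro hs.1 hs.2), abs_nonneg s, hL]
      _ < ρ / 2 := by linarith
  have hθ0 : ∀ z, θ z 0 = z := fun z => globalFlow_zero hK hVL z
  have hadd : ∀ z s t, θ z (s + t) = θ (θ z s) t := fun z s t => globalFlow_add hK hVL z s t
  refine ⟨η₀, θ, O, hη₀pos, hθc, hθ0, hadd, ?_, hmono, hanti, hOo, hZO,
    fun z hz => hreg2 z (hO2ρ hz), hclock, hband, hstay, fun s hs => ?_, fun s hs => ?_⟩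
  · exact ⟨cthickening (2 * ρ) Z, hZc.cthickening, fun z hz s =>
      globalFlow_eq_self_of_eq_zero hK hVL (hV0 z hz) s⟩
  · -- `θ_{-s}` carries `{F ≤ 0}` onto `{F ≤ -s}`
    have hs' : -s ∈ Icc (-(4 * η₀)) (4 * η₀) := ⟨by linarith [hs.2], by linarith [hs.1]⟩
    refine Subset.antisymm ?_ fun w hw => ?_
    · rintro _ ⟨z, hz, rfl⟩
      show F (θ z (-s)) ≤ -s
      rcases le_or_gt (F z) (-s) with hzs | hzs
      · have h := (hmono z) (show -s ≤ 0 by linarith [hs.1])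
        simp only [hθ0] at h
        exact h.trans hzs
      · rw [hclock z (hband z hz (by linarith [hs.2])) (-s) hs']
        have : F z ≤ 0 := hz
        linarith
    · refine ⟨θ w s, ?_, ?_⟩
      · show F (θ w s) ≤ 0
        have h := (hanti w) hs.1
        simp only [hθ0, sub_zero] at h
        have hw' : F w ≤ -s := hw
        linarith
      · show θ (θ w s) (-s) = w
        rw [← hadd, add_neg_cancel, hθ0]
  · -- `θ_{-s}` carries `{F = 0}` onto `{F = -s}`
    have hs' : -s ∈ Icc (-(4 * η₀)) (4 * η₀) := ⟨by linarith [hs.2], by linarith [hs.1]⟩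
    refine Subset.antisymm ?_ fun w hw => ?_
    · rintro _ ⟨z, hz, rfl⟩
      show F (θ z (-s)) = -s
      rw [hclock z (hZO hz) (-s) hs']
      have : F z = 0 := hz
      linarith
    · have hw' : F w = -s := hw
      have hwO : w ∈ O := hband w (by linarith [hs.1]) (by linarith [hs.2])
      refine ⟨θ w s, ?_, ?_⟩
      · show F (θ w s) = 0
        rw [hclock w hwO s ⟨by linarith [hs.1], hs.2⟩]
        linarith
      · show θ (θ w s) (-s) = w
        rw [← hadd, add_neg_cancel, hθ0]

end Gradient

/-! ### Euclidean collar data from the gradient collar flow -/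

section Collar

variable {n : ℕ} {N : Type u} [TopologicalSpace N] [ChartedSpace (EuclideanSpace ℝ (Fin (n + 1))) N]
  [Nonempty N]

/-- **The gradient collar of `e(N) = {F = 0}`.**  Let `F : ℝⁿ⁺² → ℝ` be `C^∞` with `{F ≤ 0}`
compact and `dF ≠ 0` on `{F = 0}`, and let `e : N → ℝⁿ⁺²` be a smooth embedding onto `{F = 0}`.
With the gradient collar flow `θ` and the time `η₀` of `exists_gradientCollarFlow`: every time
map `θ_s ∘ e` is a smooth embedding, and for every `η ∈ (0, η₀]` the map
`(x, t) ↦ θ_{-ηt} (e x)` underlies Euclidean collar data (`EuclideanCollarData`, parameter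
interval `(-1, 2)`) with `F (θ_{-ηt} (e x)) = -ηt` (`|t| ≤ 4`) sweeping every level
`{F = -ηt}`, `0 ≤ t ≤ 4`, exactly; in particular (`EuclideanCollarData.isSmoothEmbedding_collarMap`)
`N × [0, 1] → ℝⁿ⁺²`, `(x, t) ↦ θ_{-ηt} (e x)` is a smooth embedding from `e` to the level `{F = -η}`.
[cite: Milnor1963, Thm. 3.1] [cite: MilnorHCobordism1965, Thm. 3.4] -/
theorem exists_euclideanCollarData {F : EuclideanSpace ℝ (Fin (n + 2)) → ℝ} (hF : ContDiff ℝ ∞ F)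
    (hD : IsCompact {x | F x ≤ 0}) (hreg : ∀ x, F x = 0 → fderiv ℝ F x ≠ 0)
    {e : N → EuclideanSpace ℝ (Fin (n + 2))}
    (he : Manifold.IsSmoothEmbedding (𝓡 (n + 1)) (𝓡 (n + 2)) ∞ e)
    (hrange : range e = {x | F x = 0}) :
    ∃ (η₀ : ℝ) (θ : EuclideanSpace ℝ (Fin (n + 2)) → ℝ → EuclideanSpace ℝ (Fin (n + 2))),
      0 < η₀ ∧ ContDiff ℝ ∞ (fun p : EuclideanSpace ℝ (Fin (n + 2)) × ℝ => θ p.1 p.2) ∧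
      (∀ z, θ z 0 = z) ∧ (∀ z s t, θ z (s + t) = θ (θ z s) t) ∧
      (∃ S : Set (EuclideanSpace ℝ (Fin (n + 2))), IsCompact S ∧ ∀ z ∉ S, ∀ s, θ z s = z) ∧
      (∀ z, Monotone fun s => F (θ z s)) ∧ (∀ z, Antitone fun s => F (θ z s) - s) ∧
      (∀ z, F z ≤ 0 → -(4 * η₀) ≤ F z → fderiv ℝ F z ≠ 0) ∧
      (∀ s ∈ Icc 0 (4 * η₀), (fun z => θ z (-s)) '' {x | F x ≤ 0} = {x | F x ≤ -s}) ∧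
      (∀ s ∈ Icc 0 (4 * η₀), (fun z => θ z (-s)) '' {x | F x = 0} = {x | F x = -s}) ∧
      (∀ s, Manifold.IsSmoothEmbedding (𝓡 (n + 1)) (𝓡 (n + 2)) ∞ fun x => θ (e x) s) ∧
      ∀ η ∈ Ioc 0 η₀, ∃ D : EuclideanCollarData n N, D.bot = -1 ∧ D.top = 2 ∧
        (∀ x t, D.toFun x t = θ (e x) (-(η * t))) ∧ (∀ x, D.toFun x 0 = e x) ∧
        (∀ x, ∀ t ∈ Icc (-4 : ℝ) 4, F (D.toFun x t) = -(η * t)) ∧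
        (∀ t ∈ Icc (0 : ℝ) 4, range (fun x => D.toFun x t) = {z | F z = -(η * t)}) := by
  obtain ⟨η₀, θ, O, hη₀, hθc, hθ0, hadd, hS, hmono, hanti, hOo, hZO, hregO, hclock, hband, hstay,
    hsub, hlev⟩ := exists_gradientCollarFlow hF hD hreg
  have hinj : Injective e := he.isEmbedding.injective
  have heZ : ∀ x, F (e x) = 0 := fun x => by
    have : e x ∈ range e := mem_range_self x
    rwa [hrange] at this
  have hθs : ∀ s, ContDiff ℝ ∞ fun z => θ z s := fun s =>
    hθc.comp (contDiff_id.prodMk contDiff_const)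
  -- the time maps are diffeomorphisms
  let Θ : ℝ → EuclideanSpace ℝ (Fin (n + 2)) ≃ₘ⟮𝓡 (n + 2), 𝓡 (n + 2)⟯
      EuclideanSpace ℝ (Fin (n + 2)) := fun s =>
    { toFun := fun z => θ z s
      invFun := fun z => θ z (-s)
      left_inv := fun z => by simp only [← hadd, add_neg_cancel, hθ0]
      right_inv := fun z => by simp only [← hadd, neg_add_cancel, hθ0]
      contMDiff_toFun := (hθs s).contMDiff
      contMDiff_invFun := (hθs (-s)).contMDiff }
  have hemb : ∀ s, Manifold.IsSmoothEmbedding (𝓡 (n + 1)) (𝓡 (n + 2)) ∞ fun x => θ (e x) s :=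
    fun s => he.diffeomorph_comp (Θ s)
  refine ⟨η₀, θ, hη₀, hθc, hθ0, hadd, hS, hmono, hanti,
    fun z hz hz' => hregO z (hband z hz hz'), hsub, hlev, hemb, fun η hη => ?_⟩
  have hηpos : 0 < η := hη.1
  have hη4 : ∀ t ∈ Icc (-4 : ℝ) 4, -(η * t) ∈ Icc (-(4 * η₀)) (4 * η₀) := fun t ht =>
    ⟨by nlinarith [ht.2, hη.2, hηpos], by nlinarith [ht.1, hη.2, hηpos]⟩
  -- the clock from the hypersurface
  have hFt : ∀ x, ∀ t ∈ Icc (-4 : ℝ) 4, F (θ (e x) (-(η * t))) = -(η * t) := fun x t ht => by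
    rw [hclock (e x) (hZO (heZ x)) _ (hη4 t ht), heZ, zero_add]
  -- the smooth left inverse of `e`
  have hinv : ContMDiffOn (𝓡 (n + 2)) (𝓡 (n + 1)) ∞ (invFun e) (range e) :=
    contMDiffOn_leftInverse_of_isImmersion he.isImmersion he.isEmbedding (leftInverse_invFun hinj)
  -- the projection to the hypersurface along the flow
  set π : EuclideanSpace ℝ (Fin (n + 2)) → EuclideanSpace ℝ (Fin (n + 2)) :=
    fun z => θ z (-F z) with hπ
  have hπc : ContDiff ℝ ∞ π := hθc.comp (contDiff_id.prodMk hF.neg)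
  set region : Set (EuclideanSpace ℝ (Fin (n + 2))) := O ∩ F ⁻¹' Ioo (-(2 * η)) η with hregion
  have hregion_clock : ∀ z ∈ region, F (π z) = 0 := by
    rintro z ⟨hzO, hzF⟩
    rw [hπ, hclock z hzO (-F z) ⟨by linarith [hzF.2, hη.2], by linarith [hzF.1, hη.2]⟩,
      add_neg_cancel]
  have hπZ : ∀ z ∈ region, π z ∈ range e := fun z hz => by
    rw [hrange]; exact hregion_clock z hz
  refine ⟨{ toFun := fun x t => θ (e x) (-(η * t))
            proj := fun z => invFun e (π z)
            height := fun z => -F z / η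
            bot := -1
            top := 2
            region := region
            bot_neg := by norm_num
            one_lt_top := by norm_num
            isOpen_region := hOo.inter (isOpen_Ioo.preimage hF.continuous)
            mem_region := ?_
            proj_apply := ?_
            height_apply := ?_
            height_mem := ?_
            apply_proj_height := ?_
            contMDiffOn_toFun := ?_
            contMDiffOn_proj := ?_
            contMDiffOn_height := ((hF.neg.div_const η).contMDiff).contMDiffOn }, rfl, rfl,
    fun x t => rfl, fun x => by simp only [mul_zero, neg_zero, hθ0], hFt, ?_⟩
  · -- mem_region
    intro x t ht
    have ht4 : t ∈ Icc (-4 : ℝ) 4 := ⟨by linarith [ht.1], by linarith [ht.2]⟩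
    refine ⟨hstay (e x) (heZ x) _ (hη4 t ht4), ?_⟩
    show F (θ (e x) (-(η * t))) ∈ Ioo (-(2 * η)) η
    rw [hFt x t ht4]
    exact ⟨by nlinarith [ht.2], by nlinarith [ht.1]⟩
  · -- proj_apply
    intro x t ht
    have ht4 : t ∈ Icc (-4 : ℝ) 4 := ⟨by linarith [ht.1], by linarith [ht.2]⟩
    show invFun e (θ (θ (e x) (-(η * t))) (-F (θ (e x) (-(η * t))))) = x
    rw [hFt x t ht4, neg_neg, ← hadd, neg_add_cancel, hθ0]
    exact leftInverse_invFun hinj x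
  · -- height_apply
    intro x t ht
    have ht4 : t ∈ Icc (-4 : ℝ) 4 := ⟨by linarith [ht.1], by linarith [ht.2]⟩
    show -F (θ (e x) (-(η * t))) / η = t
    rw [hFt x t ht4, neg_neg, mul_div_cancel_left₀ t hηpos.ne']
  · -- height_mem
    rintro z ⟨-, hzF⟩
    show -F z / η ∈ Ioo (-1 : ℝ) 2
    constructor
    · rw [lt_div_iff₀ hηpos]; linarith [hzF.2]
    · rw [div_lt_iff₀ hηpos]; linarith [hzF.1]
  · -- apply_proj_height
    intro z hz
    show θ (e (invFun e (π z))) (-(η * (-F z / η))) = z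
    rw [invFun_eq (hπZ z hz)]
    have : -(η * (-F z / η)) = F z := by field_simp
    rw [this, hπ, ← hadd, neg_add_cancel, hθ0]
  · -- contMDiffOn_toFun
    have h1 : ContMDiff ((𝓡 (n + 1)).prod 𝓘(ℝ, ℝ)) 𝓘(ℝ, EuclideanSpace ℝ (Fin (n + 2)) × ℝ) ∞
        fun q : N × ℝ => (e q.1, -(η * q.2)) :=
      (he.contMDiff.comp contMDiff_fst).prodMk_space
        ((contDiff_const.mul contDiff_id).neg.contMDiff.comp contMDiff_snd)
    exact (hθc.contMDiff.comp h1).contMDiffOn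
  · -- contMDiffOn_proj
    exact hinv.comp hπc.contMDiff.contMDiffOn fun z hz => hπZ z hz
  · -- the levels swept
    intro t ht
    have ht4 : t ∈ Icc (-4 : ℝ) 4 := ⟨by linarith [ht.1], ht.2⟩
    refine Subset.antisymm ?_ fun z hz => ?_
    · rintro _ ⟨x, rfl⟩
      exact hFt x t ht4
    · have hzF : F z = -(η * t) := hz
      have hzO : z ∈ O := hband z (by rw [hzF]; nlinarith [ht.1]) (by rw [hzF]; exact (hη4 t ht4).1)
      have h0 : F (θ z (η * t)) = 0 := by
        rw [hclock z hzO (η * t) ⟨by nlinarith [ht.1, hη.2], by nlinarith [ht.2, hη.2]⟩, hzF,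
          neg_add_cancel]
      have hmem : θ z (η * t) ∈ range e := by rw [hrange]; exact h0
      obtain ⟨x, hx⟩ := hmem
      refine ⟨x, ?_⟩
      show θ (e x) (-(η * t)) = z
      rw [hx, ← hadd, add_neg_cancel, hθ0]

end Collar

/-! ### The regular interval theorem in Euclidean form: the collar across a regular band -/

section Band

variable {E : Type*} [NormedAddCommGroup E] [InnerProductSpace ℝ E] [FiniteDimensional ℝ E]
  {F : E → ℝ}

/-- **The gradient flow across a compact regular band** (Milnor's regular interval theorem, in
`E`): if `F` is `C^∞`, the band `Z = {lo' ≤ F ≤ hi'}` is compact and `dF ≠ 0` on it, there is a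
jointly smooth complete flow `θ` of `E`, the identity off a compact set, with `F` non-decreasing
of slope `≤ 1` along it, such that **`F (θ_s z) = F z + s` whenever `z ∈ Z` and
`F z + s ∈ [lo', hi']`** (the flow of the normalised gradient, cut off; the clock is propagated
across the band in steps of bounded length). [cite: Milnor1963, Thm. 3.1] -/
theorem exists_bandFlow (hF : ContDiff ℝ ∞ F) {lo' hi' : ℝ}
    (hZ : IsCompact {x | F x ∈ Icc lo' hi'}) (hreg : ∀ x, F x ∈ Icc lo' hi' → fderiv ℝ F x ≠ 0) :
    ∃ θ : E → ℝ → E, ContDiff ℝ ∞ (fun p : E × ℝ => θ p.1 p.2) ∧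
      (∀ z, θ z 0 = z) ∧ (∀ z s t, θ z (s + t) = θ (θ z s) t) ∧
      (∃ S : Set E, IsCompact S ∧ ∀ z ∉ S, ∀ s, θ z s = z) ∧
      (∀ z, Monotone fun s => F (θ z s)) ∧ (∀ z, Antitone fun s => F (θ z s) - s) ∧
      ∀ z, F z ∈ Icc lo' hi' → ∀ s, F z + s ∈ Icc lo' hi' → F (θ z s) = F z + s := by
  haveI : CompleteSpace E := FiniteDimensional.complete ℝ E
  set Z : Set E := {x | F x ∈ Icc lo' hi'} with hZdef
  obtain ⟨ρ, L, V, hρ, hL, hVc, hVcs, hdFV, hdFV1, hVL, hV0, -⟩ :=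
    exists_gradientCollarField hF hZ fun x hx => hreg x hx
  obtain ⟨K, hK⟩ := hVc.lipschitzWith_of_hasCompactSupport hVcs (by simp)
  set θ : E → ℝ → E := globalFlow hK hVL with hθ
  have hFd : Differentiable ℝ F := hF.differentiable (by simp)
  have hθc : ContDiff ℝ ∞ fun p : E × ℝ => θ p.1 p.2 :=
    contDiff_globalFlow (n := (⊤ : ℕ∞)) hVc le_top hK hVL
  have hθ0 : ∀ z, θ z 0 = z := fun z => globalFlow_zero hK hVL z
  have hadd : ∀ z s t, θ z (s + t) = θ (θ z s) t := fun z s t => globalFlow_add hK hVL z s t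
  have hdist : ∀ z s, dist (θ z s) z ≤ L * |s| := fun z s => dist_globalFlow_le hK hVL z s
  -- the short clock: steps of length `τ`
  set τ : ℝ := ρ / (L + 1) with hτ
  have hτpos : 0 < τ := by positivity
  have hτL : L * τ ≤ ρ := by
    rw [hτ, mul_div_assoc']
    rw [div_le_iff₀ (by positivity)]
    nlinarith [hρ.le, hL]
  have hshort : ∀ z ∈ Z, ∀ s : ℝ, |s| ≤ τ → F (θ z s) = F z + s := by
    intro z hz s hs
    refine comp_globalFlow_eq_add hFd hK hVL z fun u hu => hdFV1 _ ?_
    refine mem_cthickening_of_dist_le _ z _ _ hz ?_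
    have hu' : |u| ≤ τ := by
      rcases le_total 0 s with h0s | hs0
      · rw [uIcc_of_le h0s] at hu
        rw [abs_le]; exact ⟨by linarith [hu.1], by linarith [hu.2, (abs_le.1 hs).2]⟩
      · rw [uIcc_of_ge hs0] at hu
        rw [abs_le]; exact ⟨by linarith [hu.1, (abs_le.1 hs).1], by linarith [hu.2]⟩
    calc dist (θ z u) z ≤ L * |u| := hdist z u
      _ ≤ L * τ := by gcongr
      _ ≤ ρ := hτL
  -- the long clock, by induction on the number of steps
  have hlong : ∀ k : ℕ, ∀ z ∈ Z, ∀ s : ℝ, |s| ≤ k * τ → F z + s ∈ Icc lo' hi' →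
      F (θ z s) = F z + s := by
    intro k
    induction k with
    | zero =>
      intro z _ s hs _
      have : s = 0 := abs_nonpos_iff.1 (by simpa using hs)
      rw [this, hθ0, add_zero]
    | succ k ih =>
      intro z hz s hs hs'
      have hk1 : (0 : ℝ) < k + 1 := by positivity
      -- split `s = s₀ + s₁`, `s₀ = (k/(k+1)) s`, `s₁ = s/(k+1)`
      set s₁ : ℝ := s / (k + 1) with hs₁
      set s₀ : ℝ := s - s₁ with hs₀
      have hs₀' : s₀ = (k / (k + 1)) * s := by
        rw [hs₀, hs₁]; field_simp; ring
      have habs₁ : |s₁| ≤ τ := by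
        rw [hs₁, abs_div, abs_of_pos hk1, div_le_iff₀ hk1]
        calc |s| ≤ (k + 1 : ℕ) * τ := hs
          _ = τ * (k + 1) := by push_cast; ring
      have habs₀ : |s₀| ≤ k * τ := by
        rw [hs₀', abs_mul, abs_of_nonneg (by positivity)]
        calc (k : ℝ) / (k + 1) * |s| ≤ k / (k + 1) * ((k + 1 : ℕ) * τ) := by gcongr
          _ = k * τ := by push_cast; field_simp
      -- `F z + s₀` lies between `F z` and `F z + s`
      have hmid : F z + s₀ ∈ Icc lo' hi' := by
        have hc0 : (0 : ℝ) ≤ k / (k + 1) := by positivity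
        have hc1 : (k : ℝ) / (k + 1) ≤ 1 := by rw [div_le_one hk1]; linarith
        rw [hs₀']
        constructor
        · rcases le_total 0 s with h | h
          · nlinarith [hz.1, hs'.1]
          · nlinarith [hz.1, hs'.1]
        · rcases le_total 0 s with h | h
          · nlinarith [hz.2, hs'.2]
          · nlinarith [hz.2, hs'.2]
      have h0 := ih z hz s₀ habs₀ hmid
      have hz' : θ z s₀ ∈ Z := by
        show F (θ z s₀) ∈ Icc lo' hi'
        rw [h0]; exact hmid
      have h1 := hshort (θ z s₀) hz' s₁ habs₁
      have hsum : s = s₀ + s₁ := by rw [hs₀]; ring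
      rw [hsum, hadd, h1, h0, add_assoc]
  refine ⟨θ, hθc, hθ0, hadd, ⟨cthickening (2 * ρ) Z, hZ.cthickening, fun z hz s =>
      globalFlow_eq_self_of_eq_zero hK hVL (hV0 z hz) s⟩,
    fun z => monotone_comp_globalFlow hFd hK hVL (fun x => (hdFV x).1) z,
    fun z => antitone_comp_globalFlow_sub hFd hK hVL (fun x => (hdFV x).2) z,
    fun z hz s hs => ?_⟩
  obtain ⟨k, hk⟩ := exists_nat_ge (|s| / τ)
  exact hlong k z hz s (by rwa [div_le_iff₀ hτpos] at hk) hs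

end Band

section BandCollar

variable {n : ℕ} {N : Type u} [TopologicalSpace N] [ChartedSpace (EuclideanSpace ℝ (Fin (n + 1))) N]
  [Nonempty N]

/-- **The collar across a regular band** (the regular interval theorem realised in `ℝⁿ⁺²`): let
`F` be `C^∞` with compact band `{lo' ≤ F ≤ hi'}` free of critical points, `lo' < lo < hi < hi'`,
and let `e : N → ℝⁿ⁺²` be a smooth embedding onto the level `{F = hi}`.  Then with the band flow
`θ` (`exists_bandFlow`) the map `(x, t) ↦ θ_{-(hi - lo) t} (e x)` underlies Euclidean collar data
(`EuclideanCollarData`) on which `F = hi - (hi - lo) t`, sweeping each level of the band exactly;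
in particular (`EuclideanCollarData.isSmoothEmbedding_collarMap`) **`N × [0, 1] → ℝⁿ⁺²`,
`(x, t) ↦ θ_{-(hi - lo) t} (e x)`, is a smooth embedding from `e` (`t = 0`) onto the region
`{lo ≤ F ≤ hi}`, ending on the level `{F = lo}`**, and every `θ_s ∘ e` is a smooth embedding.
[cite: Milnor1963, Thm. 3.1] [cite: MilnorHCobordism1965, Thm. 3.4] -/
theorem exists_euclideanCollarData_of_band {F : EuclideanSpace ℝ (Fin (n + 2)) → ℝ}
    (hF : ContDiff ℝ ∞ F) {lo' lo hi hi' : ℝ} (hlo : lo' < lo) (hlohi : lo < hi) (hhi : hi < hi')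
    (hZ : IsCompact {x | F x ∈ Icc lo' hi'}) (hreg : ∀ x, F x ∈ Icc lo' hi' → fderiv ℝ F x ≠ 0)
    {e : N → EuclideanSpace ℝ (Fin (n + 2))}
    (he : Manifold.IsSmoothEmbedding (𝓡 (n + 1)) (𝓡 (n + 2)) ∞ e)
    (hrange : range e = {x | F x = hi}) :
    ∃ (θ : EuclideanSpace ℝ (Fin (n + 2)) → ℝ → EuclideanSpace ℝ (Fin (n + 2)))
      (D : EuclideanCollarData n N),
      ContDiff ℝ ∞ (fun p : EuclideanSpace ℝ (Fin (n + 2)) × ℝ => θ p.1 p.2) ∧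
      (∀ z, θ z 0 = z) ∧ (∀ z s t, θ z (s + t) = θ (θ z s) t) ∧
      (∃ S : Set (EuclideanSpace ℝ (Fin (n + 2))), IsCompact S ∧ ∀ z ∉ S, ∀ s, θ z s = z) ∧
      (∀ z, F z ∈ Icc lo' hi' → ∀ s, F z + s ∈ Icc lo' hi' → F (θ z s) = F z + s) ∧
      (∀ s, Manifold.IsSmoothEmbedding (𝓡 (n + 1)) (𝓡 (n + 2)) ∞ fun x => θ (e x) s) ∧
      (∀ x t, D.toFun x t = θ (e x) (-((hi - lo) * t))) ∧ (∀ x, D.toFun x 0 = e x) ∧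
      D.bot < 0 ∧ 1 < D.top ∧
      (∀ x t, hi - (hi - lo) * t ∈ Icc lo' hi' → F (D.toFun x t) = hi - (hi - lo) * t) ∧
      (∀ t, hi - (hi - lo) * t ∈ Icc lo' hi' →
        range (fun x => D.toFun x t) = {z | F z = hi - (hi - lo) * t}) := by
  obtain ⟨θ, hθc, hθ0, hadd, hS, -, -, hclock⟩ := exists_bandFlow hF hZ hreg
  have hinj : Injective e := he.isEmbedding.injective
  have heZ : ∀ x, F (e x) = hi := fun x => by
    have : e x ∈ range e := mem_range_self x
    rwa [hrange] at this
  have hhiZ : hi ∈ Icc lo' hi' := ⟨by linarith, hhi.le⟩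
  have hθs : ∀ s, ContDiff ℝ ∞ fun z => θ z s := fun s =>
    hθc.comp (contDiff_id.prodMk contDiff_const)
  let Θ : ℝ → EuclideanSpace ℝ (Fin (n + 2)) ≃ₘ⟮𝓡 (n + 2), 𝓡 (n + 2)⟯
      EuclideanSpace ℝ (Fin (n + 2)) := fun s =>
    { toFun := fun z => θ z s
      invFun := fun z => θ z (-s)
      left_inv := fun z => by simp only [← hadd, add_neg_cancel, hθ0]
      right_inv := fun z => by simp only [← hadd, neg_add_cancel, hθ0]
      contMDiff_toFun := (hθs s).contMDiff
      contMDiff_invFun := (hθs (-s)).contMDiff }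
  have hemb : ∀ s, Manifold.IsSmoothEmbedding (𝓡 (n + 1)) (𝓡 (n + 2)) ∞ fun x => θ (e x) s :=
    fun s => he.diffeomorph_comp (Θ s)
  have hd : 0 < hi - lo := by linarith
  -- the clock from the level `hi`
  have hFt : ∀ x t, hi - (hi - lo) * t ∈ Icc lo' hi' →
      F (θ (e x) (-((hi - lo) * t))) = hi - (hi - lo) * t := fun x t ht => by
    rw [hclock (e x) (by rw [heZ]; exact hhiZ) _ (by rw [heZ, ← sub_eq_add_neg]; exact ht), heZ,
      ← sub_eq_add_neg]
  -- the smooth left inverse of `e` and the projection to the level `hi` along the flow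
  have hinv : ContMDiffOn (𝓡 (n + 2)) (𝓡 (n + 1)) ∞ (invFun e) (range e) :=
    contMDiffOn_leftInverse_of_isImmersion he.isImmersion he.isEmbedding (leftInverse_invFun hinj)
  set π : EuclideanSpace ℝ (Fin (n + 2)) → EuclideanSpace ℝ (Fin (n + 2)) :=
    fun z => θ z (hi - F z) with hπ
  have hπc : ContDiff ℝ ∞ π := hθc.comp (contDiff_id.prodMk (contDiff_const.sub hF))
  have hπZ : ∀ z, F z ∈ Icc lo' hi' → π z ∈ range e := fun z hz => by
    rw [hrange]
    show F (θ z (hi - F z)) = hi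
    rw [hclock z hz _ (by rw [add_sub_cancel]; exact hhiZ), add_sub_cancel]
  -- the parameter interval and the region
  set bot : ℝ := -((hi' - hi) / (2 * (hi - lo))) with hbot
  set top : ℝ := 1 + (lo - lo') / (2 * (hi - lo)) with htop
  have hbot_neg : bot < 0 := by
    rw [hbot, neg_lt_zero]; positivity
  have htop_gt : 1 < top := by
    rw [htop, lt_add_iff_pos_right]; exact div_pos (by linarith) (by positivity)
  have hlev_bot : hi - (hi - lo) * bot = hi + (hi' - hi) / 2 := by
    rw [hbot]; field_simp; ring
  have hlev_top : hi - (hi - lo) * top = lo - (lo - lo') / 2 := by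
    rw [htop]; field_simp; ring
  have hlev : ∀ t ∈ Ioo bot top,
      hi - (hi - lo) * t ∈ Ioo (lo - (lo - lo') / 2) (hi + (hi' - hi) / 2) := fun t ht =>
    ⟨by rw [← hlev_top]; nlinarith [ht.2], by rw [← hlev_bot]; nlinarith [ht.1]⟩
  have hIoo : Ioo (lo - (lo - lo') / 2) (hi + (hi' - hi) / 2) ⊆ Icc lo' hi' := fun c hc =>
    ⟨by linarith [hc.1], by linarith [hc.2]⟩
  set region : Set (EuclideanSpace ℝ (Fin (n + 2))) :=
    F ⁻¹' Ioo (lo - (lo - lo') / 2) (hi + (hi' - hi) / 2) with hregion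
  refine ⟨θ, { toFun := fun x t => θ (e x) (-((hi - lo) * t))
               proj := fun z => invFun e (π z)
               height := fun z => (hi - F z) / (hi - lo)
               bot := bot
               top := top
               region := region
               bot_neg := hbot_neg
               one_lt_top := htop_gt
               isOpen_region := isOpen_Ioo.preimage hF.continuous
               mem_region := ?_
               proj_apply := ?_
               height_apply := ?_
               height_mem := ?_
               apply_proj_height := ?_
               contMDiffOn_toFun := ?_
               contMDiffOn_proj := ?_
               contMDiffOn_height := ((contDiff_const.sub hF).div_const _).contMDiff.contMDiffOn },
    hθc, hθ0, hadd, hS, hclock, hemb, fun x t => rfl, fun x => by simp only [mul_zero, neg_zero, hθ0],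
    hbot_neg, htop_gt, hFt, ?_⟩
  · -- mem_region
    intro x t ht
    show F (θ (e x) (-((hi - lo) * t))) ∈ Ioo _ _
    rw [hFt x t (hIoo (hlev t ht))]
    exact hlev t ht
  · -- proj_apply
    intro x t ht
    show invFun e (θ (θ (e x) (-((hi - lo) * t))) (hi - F (θ (e x) (-((hi - lo) * t))))) = x
    rw [hFt x t (hIoo (hlev t ht)), sub_sub_cancel, ← hadd, neg_add_cancel, hθ0]
    exact leftInverse_invFun hinj x
  · -- height_apply
    intro x t ht
    show (hi - F (θ (e x) (-((hi - lo) * t)))) / (hi - lo) = t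
    rw [hFt x t (hIoo (hlev t ht)), sub_sub_cancel, mul_div_cancel_left₀ t hd.ne']
  · -- height_mem
    intro z hz
    have hz' : F z ∈ Ioo (lo - (lo - lo') / 2) (hi + (hi' - hi) / 2) := hz
    show (hi - F z) / (hi - lo) ∈ Ioo bot top
    have hd' : hi - lo ≠ 0 := hd.ne'
    constructor
    · rw [hbot, lt_div_iff₀ hd]
      have : -((hi' - hi) / (2 * (hi - lo))) * (hi - lo) = -((hi' - hi) / 2) := by
        field_simp
      rw [this]; linarith [hz'.2]
    · rw [htop, div_lt_iff₀ hd]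
      have : (1 + (lo - lo') / (2 * (hi - lo))) * (hi - lo) = (hi - lo) + (lo - lo') / 2 := by
        field_simp
      rw [this]; linarith [hz'.1]
  · -- apply_proj_height
    intro z hz
    have hz' : F z ∈ Icc lo' hi' := hIoo hz
    show θ (e (invFun e (π z))) (-((hi - lo) * ((hi - F z) / (hi - lo)))) = z
    rw [invFun_eq (hπZ z hz'), mul_div_cancel₀ _ hd.ne', hπ, ← hadd, add_neg_cancel, hθ0]
  · -- contMDiffOn_toFun
    have h1 : ContMDiff ((𝓡 (n + 1)).prod 𝓘(ℝ, ℝ)) 𝓘(ℝ, EuclideanSpace ℝ (Fin (n + 2)) × ℝ) ∞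
        fun q : N × ℝ => (e q.1, -((hi - lo) * q.2)) :=
      (he.contMDiff.comp contMDiff_fst).prodMk_space
        ((contDiff_const.mul contDiff_id).neg.contMDiff.comp contMDiff_snd)
    exact (hθc.contMDiff.comp h1).contMDiffOn
  · -- contMDiffOn_proj
    exact hinv.comp hπc.contMDiff.contMDiffOn fun z hz => hπZ z (hIoo hz)
  · -- the levels swept
    intro t ht
    refine Subset.antisymm ?_ fun z hz => ?_
    · rintro _ ⟨x, rfl⟩
      exact hFt x t ht
    · have hzF : F z = hi - (hi - lo) * t := hz
      have hzZ : F z ∈ Icc lo' hi' := by rw [hzF]; exact ht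
      have hmem : θ z ((hi - lo) * t) ∈ range e := by
        rw [hrange]
        show F (θ z ((hi - lo) * t)) = hi
        rw [hclock z hzZ _ (by rw [hzF, sub_add_cancel]; exact hhiZ), hzF, sub_add_cancel]
      obtain ⟨x, hx⟩ := hmem
      refine ⟨x, ?_⟩
      show θ (e x) (-((hi - lo) * t)) = z
      rw [hx, ← hadd, add_neg_cancel, hθ0]

end BandCollar

end Literature.Topology.FourManifolds

end
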